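import Mathlib
import HarnessLib
import Summits.ValiantsHypothesis.ValiantsHypothesis.Theses.MonotoneRestoration
import Literature.Computability.AlgebraicComplexity.ArithCircuit
import Literature.Computability.AlgebraicComplexity.ArithCircuitProofs
import Literature.Computability.AlgebraicComplexity.MonotoneStructure
import Literature.Computability.AlgebraicComplexity.PermanentIrreducible
import Literature.ModelTheory.FiniteModelTheory.CkEquiv
import Summits.ValiantsHypothesis.ValiantsHypothesis.Theorems.MonotoneRestorationMonotoneRestorationQPCosetCount
import Summits.ValiantsHypothesis.ValiantsHypothesis.Theorems.MonotoneRestorationMonotoneRestorationQPSymmetricLB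
import Summits.ValiantsHypothesis.ValiantsHypothesis.Theorems.MonotoneRestorationMonotoneRestorationQPSupportSymmetrisation
import Summits.ValiantsHypothesis.ValiantsHypothesis.Theorems.MonotoneRestorationMonotoneRestorationQPSparseRegime
import Summits.ValiantsHypothesis.ValiantsHypothesis.Theorems.MonotoneRestorationMonotoneRestorationQPBeta
import Literature.Computability.AlgebraicComplexity.SymmetricArithCircuit
import Literature.Computability.AlgebraicComplexity.DawarWilsenach2025Proofs
import Literature.GroupTheory.PermutationGroups.SmallIndexSubgroups
import Summits.ValiantsHypothesis.ValiantsHypothesis.Theorems.MonotoneRestorationQP.Negative.LoadBearing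
import Summits.ValiantsHypothesis.ValiantsHypothesis.Theorems.MonotoneRestorationMonotoneRestorationQPPermSupportCount

/-! TTRL-lite variant V19405 of stmt-ValiantsHypothesis-15886 -/

namespace Summit.ValiantsHypothesis.ValiantsHypothesis.Theorems

open Summit.ValiantsHypothesis.ValiantsHypothesis.Theses.MonotoneRestoration
open Literature.Computability.AlgebraicComplexity

/-- TTRL-lite variant V19405 (`c = 0` specialisation of `stub_gammaArithmetic`): with
`k = (log₂ n + 0) ^ 0 + 2 = 3` constant, every conjunct holds from `n ≥ 24` on — the four
arithmetic ones by linear arithmetic and `2 < C(n, 3)` by monotonicity of `Nat.choose` in `n`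
from `C(24, 3) = 2024`. -/
theorem stub_gammaArithmetic_var19405 :
    ∃ N : ℕ, ∀ n : ℕ, N ≤ n → 8 < n ∧ 4 * ((Nat.log 2 n + 0) ^ 0 + 2) ≤ n ∧
      ((Nat.log 2 n + 0) ^ 0 + 2) * ((Nat.log 2 n + 0) ^ 0 + 2) ≤ n / 2 ∧
      n / 2 + ((Nat.log 2 n + 0) ^ 0 + 2) + 9 ≤ n ∧
      2 ^ ((Nat.log 2 n + 0) ^ 0) < n.choose ((Nat.log 2 n + 0) ^ 0 + 2) := by
  refine ⟨24, fun n hn => ?_⟩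
  simp only [Nat.add_zero, pow_zero, pow_one, Nat.reduceAdd, Nat.reduceMul]
  have h24 : 2 < Nat.choose 24 3 := by decide
  have hmono : Nat.choose 24 3 ≤ n.choose 3 := Nat.choose_le_choose 3 hn
  refine ⟨by omega, by omega, by omega, by omega, ?_⟩
  exact lt_of_lt_of_le h24 hmono

end Summit.ValiantsHypothesis.ValiantsHypothesis.Theorems
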